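import Literature.Analysis.FunctionSpaces.PVPrograms
import Mathlib.Algebra.Order.BigOperators.Group.Finset
import HarnessLib

/-!
# Programming in Cobham's algebra: tables, bounded search, recursion with counterexample search

Continuation of `PVPrograms.lean` (support for the witnessing theorem of `S₂¹` in `PV` form,
Buss 1986, Ch. 5–6; Krajíček 1995, §7.6).  Further `PV` symbols with their semantics on `ℕ`:

* `PVFun.pow2Min (i, w) = 2^{min(i, |w|)}` and `PVFun.onesMin (i, w) = 2^{min(i, |w|)} - 1` (a
  number of length `min (i, |w|)`): exponentials are available below a length (Buss 1986, §2.4);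
* `PVFun.entry (w, i, c)` — the `i`-th digit of `w` in base `2^{|c|}`
  (`= ⌊w / 2^{i·|c|}⌋ mod 2^{|c|}`, sequence decoding, Buss 1986, §2.5);
* `PVFun.tbl F B` — the **table** `u ↦ ⟨min (F(ȳ, i), B ȳ)⟩_{i ≤ |u|}` of the values of a symbol
  at the lengths `0, …, |u|`, truncated at `B`, in base `2^{|2B+1|}` (sequence coding by limited
  recursion on notation; Buss 1986, §2.5; it is the collecting function used for sharply bounded
  replacement in Krajíček 1995, §7.6, proof of Thm. 7.6.3), with `entry_tbl`;
* `PVFun.lsearch G` — the least `i ≤ |u|` with `G(ȳ, i) = 0` (else `|u| + 1`): sharply bounded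
  minimisation (Buss 1986, Ch. 6; Cook 1975, §2);
* `PVFun.cex Gd` — along the notation of `x`, a point `c ≠ 0` with `Gd(ȳ, ⌊c/2⌋) ≠ 0` and
  `Gd(ȳ, c) = 0`, which exists as soon as `Gd(ȳ, 0) ≠ 0` and `Gd(ȳ, x) = 0`: the *counterexample
  search* that turns the open polynomial induction of `PV` into universal sentences
  (Krajíček 1995, §5.3 / Thm. 7.6.3; Cook 1975, §2, rule of induction on notation);
* `PVFun.recW G T` — `H(ȳ, v, 0) = min(v, T(ȳ,0))`, `H(ȳ, v, sⱼ y) = min (G(ȳ, sⱼ y, H(ȳ,v,y)),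
  T(ȳ, sⱼ y))`: limited recursion on notation in the argument order used by the witnessing
  argument.

## References

* S. R. Buss, *Bounded Arithmetic*, Bibliopolis 1986, §2.4–2.5, Ch. 6.
* S. A. Cook, *Feasibly constructive proofs and the propositional calculus*, STOC 1975, §2.
* J. Krajíček, *Bounded Arithmetic, Propositional Logic and Complexity Theory*, CUP 1995, §5.3,
  §7.6.
-/

namespace Literature.Analysis.FunctionSpaces

namespace PVFun

open Finset

variable {n p : ℕ}

/-! ## Applying a symbol to the arguments in context -/

/-- `appLast F t (ȳ) = F(ȳ, t ȳ)`. [folklore] -/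
def appLast (F : PVFun (p + 1)) (t : PVFun p) : PVFun p := comp F (Fin.snoc (fun i => proj i) t)

/-- Semantics of `appLast`. [folklore] -/
@[simp] theorem eval_appLast (F : PVFun (p + 1)) (t : PVFun p) (y : Fin p → ℕ) :
    (appLast F t).eval y = F.eval (Fin.snoc y (t.eval y)) := by
  rw [appLast, eval_comp]; congr 1; funext i
  cases i using Fin.lastCases with
  | last => simp
  | cast i => simp

/-- `appWith F t (ȳ, y, r) = F(ȳ, t(ȳ, y, r))`: a `(p+1)`-ary symbol applied, inside the step of a
recursion with arguments `(ȳ, y, r)`, to the parameters and a term. [folklore] -/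
def appWith (F : PVFun (p + 1)) (t : PVFun (p + 2)) : PVFun (p + 2) :=
  comp F (Fin.snoc (fun i => proj (Fin.castSucc (Fin.castSucc i))) t)

/-- Semantics of `appWith`. [folklore] -/
@[simp] theorem eval_appWith (F : PVFun (p + 1)) (t : PVFun (p + 2)) (y : Fin p → ℕ) (a r : ℕ) :
    (appWith F t).eval (Fin.snoc (Fin.snoc y a) r) =
      F.eval (Fin.snoc y (t.eval (Fin.snoc (Fin.snoc y a) r))) := by
  rw [appWith, eval_comp]; congr 1; funext i
  cases i using Fin.lastCases with
  | last => simp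
  | cast i => simp

/-- The recursion variable `y` in the context `(ȳ, y, r)`. [folklore] -/
def yv : PVFun (p + 2) := proj (Fin.castSucc (Fin.last p))

/-- The previous value `r` in the context `(ȳ, y, r)`. [folklore] -/
def rv : PVFun (p + 2) := proj (Fin.last (p + 1))

/-- Semantics of `yv`. [folklore] -/
@[simp] theorem eval_yv (y : Fin p → ℕ) (a r : ℕ) :
    (yv : PVFun (p + 2)).eval (Fin.snoc (Fin.snoc y a) r) = a := by
  simp [yv]

/-- Semantics of `rv`. [folklore] -/
@[simp] theorem eval_rv (y : Fin p → ℕ) (a r : ℕ) :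
    (rv : PVFun (p + 2)).eval (Fin.snoc (Fin.snoc y a) r) = r := by
  simp [rv]

/-- The last argument as a term. [folklore] -/
def lastv : PVFun (p + 1) := proj (Fin.last p)

/-- Semantics of `lastv`. [folklore] -/
@[simp] theorem eval_lastv (y : Fin p → ℕ) (a : ℕ) :
    (lastv : PVFun (p + 1)).eval (Fin.snoc y a) = a := by
  simp [lastv]

/-! ## Exponentials below a length -/

/-- `pow2Min (i, w) = 2^{min(i, |w|)}` by recursion on the notation of `w`: double as long as the
length has not exceeded `i` (Buss 1986, §2.4: `2^{min(i,|w|)}` is `Σᵇ₁`-definable / a `PV`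
function). [cite: Buss1986, §2.4] -/
def pow2Min : PVFun 2 :=
  limRec one'
    (fun j => selT (ap₁ len (ap₁ (bit j) (proj 1))) (proj 0)
      (ap₁ (bit false) (proj (Fin.last 2))) (proj (Fin.last 2)))
    (ap₂ smash one' (proj (Fin.last 1)))

/-- `pow2Min (i, w) = 2^{min(i, |w|)}` (`Fin.snoc` form). [cite: Buss1986, §2.4] -/
theorem eval_pow2Min_snoc (i w : ℕ) : pow2Min.eval (Fin.snoc ![i] w) = 2 ^ min i (Nat.size w) := by
  induction w using Nat.binaryRec' with
  | zero => rw [pow2Min, eval_limRec_zero]; simp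
  | bit j y hy ih =>
    rw [pow2Min, eval_limRec_bit _ _ _ _ _ _ hy, ← pow2Min, ih]
    simp only [eval_selT, eval_ap₁, eval_ap₂, eval_len, eval_bit, eval_proj, eval_smash, eval_one',
      Matrix.cons_val_zero, snoc_vec1, snoc_vec2, vec3_last, vec2_last, Matrix.cons_val_one,
      size_bit' hy, Nat.size_one, one_mul]
    have hv : (if Nat.size y + 1 ≤ i then Nat.bit false (2 ^ min i (Nat.size y)) else
        2 ^ min i (Nat.size y)) = 2 ^ min i (Nat.size y + 1) := by
      split_ifs with h
      · rw [min_eq_right (by omega), min_eq_right h, Nat.bit_val, pow_succ]; simp; ring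
      · rw [min_eq_left (by omega), min_eq_left (by omega)]
    rw [hv]
    exact min_eq_left (Nat.pow_le_pow_right two_pos (min_le_right _ _))

/-- `pow2Min (i, w) = 2^{min(i, |w|)}`. [cite: Buss1986, §2.4] -/
@[simp] theorem eval_pow2Min (v : Fin 2 → ℕ) : pow2Min.eval v = 2 ^ min (v 0) (Nat.size (v 1)) := by
  rw [vec2_eq v, ← snoc_vec1, eval_pow2Min_snoc]; rfl

/-- `|2ᵐ - 1| = m`. [folklore] -/
theorem size_two_pow_sub_one (m : ℕ) : Nat.size (2 ^ m - 1) = m := by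
  apply le_antisymm
  · exact Nat.size_le.2 (Nat.sub_lt (Nat.two_pow_pos m) one_pos)
  · rcases Nat.eq_zero_or_pos m with rfl | hm
    · exact Nat.zero_le _
    · have h : m - 1 < Nat.size (2 ^ m - 1) := by
        rw [Nat.lt_size]
        have h1 : 2 ^ (m - 1) < 2 ^ m := Nat.pow_lt_pow_right (by norm_num) (by omega)
        omega
      omega

/-- `onesMin (i, w) = 2^{min(i, |w|)} - 1`, a number of length `min (i, |w|)`. [cite: Buss1986, §2.4] -/
def onesMin : PVFun 2 := ap₁ pred pow2Min

/-- `onesMin (i, w) = 2^{min(i,|w|)} - 1`. [cite: Buss1986, §2.4] -/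
@[simp] theorem eval_onesMin (v : Fin 2 → ℕ) :
    onesMin.eval v = 2 ^ min (v 0) (Nat.size (v 1)) - 1 := by
  simp [onesMin, eval_pred]

/-! ## Digits -/

/-- `|⌊2ᵏ / 2⌋| = k`. [folklore] -/
theorem size_two_pow_div_two (k : ℕ) : Nat.size (2 ^ k / 2) = k := by
  have h := size_div_two_pow (2 ^ k) 1
  rw [pow_one] at h
  rw [h, Nat.size_pow]; omega

/-- `entry (w, i, c) = ⌊w / 2^{min(i,|w|)·|c|}⌋ mod 2^{|c|}`: the `i`-th digit of `w` in base
`2^{|c|}` (sequence decoding, Buss 1986, §2.5: the function `β`). [cite: Buss1986, §2.5] -/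
def entry : PVFun 3 :=
  ap₂ lspLen (ap₂ mspLen (proj 0) (ap₁ half (ap₂ smash (ap₂ onesMin (proj 1) (proj 0)) (proj 2))))
    (proj 2)

/-- Semantics of `entry`. [cite: Buss1986, §2.5] -/
@[simp] theorem eval_entry (v : Fin 3 → ℕ) :
    entry.eval v = v 0 / 2 ^ (min (v 1) (Nat.size (v 0)) * Nat.size (v 2)) % 2 ^ Nat.size (v 2) := by
  simp only [entry, eval_ap₂, eval_ap₁, eval_lspLen, eval_mspLen, eval_half, eval_smash, eval_onesMin,
    eval_proj, Matrix.cons_val_zero, Matrix.cons_val_one, size_two_pow_sub_one,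
    size_two_pow_div_two]

/-- For `c ≠ 0` the truncation `min (i, |w|)` in `entry` is invisible:
`entry (w, i, c) = ⌊w / 2^{i·|c|}⌋ mod 2^{|c|}`. [cite: Buss1986, §2.5] -/
theorem eval_entry_of_ne_zero (w i c : ℕ) (hc : c ≠ 0) :
    entry.eval ![w, i, c] = w / 2 ^ (i * Nat.size c) % 2 ^ Nat.size c := by
  rw [eval_entry]
  simp only [Matrix.cons_val_zero, Matrix.cons_val_one, Matrix.cons_val]
  rcases le_or_gt i (Nat.size w) with h | h
  · rw [min_eq_left h]
  · rw [min_eq_right h.le]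
    have hc1 : 1 ≤ Nat.size c := Nat.size_pos.2 (Nat.pos_of_ne_zero hc)
    have h1 : w / 2 ^ (Nat.size w * Nat.size c) = 0 := by
      rw [Nat.div_eq_zero_iff]; right
      calc w < 2 ^ Nat.size w := Nat.lt_size_self w
        _ ≤ 2 ^ (Nat.size w * Nat.size c) :=
          Nat.pow_le_pow_right two_pos (Nat.le_mul_of_pos_right _ hc1)
    have h2 : w / 2 ^ (i * Nat.size c) = 0 := by
      rw [Nat.div_eq_zero_iff]; right
      calc w < 2 ^ Nat.size w := Nat.lt_size_self w
        _ ≤ 2 ^ (i * Nat.size c) :=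
          Nat.pow_le_pow_right two_pos (le_trans h.le (Nat.le_mul_of_pos_right _ hc1))
    rw [h1, h2]

/-! ## Tables (sequence coding of the values of a symbol at small arguments) -/

/-- The number `Σ_{i ≤ m} min (f i, B) · 2^{iL}`: the table of `f` at `0, …, m`, digits truncated
at `B`, base `2^L`. [cite: Buss1986, §2.5] -/
def tblNat (f : ℕ → ℕ) (B L m : ℕ) : ℕ := ∑ i ∈ range (m + 1), min (f i) B * 2 ^ (i * L)

/-- `tblNat` one step further. [folklore] -/
theorem tblNat_succ (f : ℕ → ℕ) (B L m : ℕ) :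
    tblNat f B L (m + 1) = tblNat f B L m + min (f (m + 1)) B * 2 ^ ((m + 1) * L) := by
  rw [tblNat, tblNat, sum_range_succ]

/-- `tblNat` at `0`. [folklore] -/
theorem tblNat_zero (f : ℕ → ℕ) (B L : ℕ) : tblNat f B L 0 = min (f 0) B := by
  simp [tblNat]

/-- A table with digits `< 2^L` is `< 2^{(m+1)L}`. [cite: Buss1986, §2.5] -/
theorem tblNat_lt {f : ℕ → ℕ} {B L : ℕ} (hB : B < 2 ^ L) (m : ℕ) :
    tblNat f B L m < 2 ^ ((m + 1) * L) := by
  induction m with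
  | zero =>
    rw [tblNat_zero]; simpa using lt_of_le_of_lt (min_le_right _ _) hB
  | succ m ih =>
    rw [tblNat_succ]
    have h1 : min (f (m + 1)) B * 2 ^ ((m + 1) * L) ≤ (2 ^ L - 1) * 2 ^ ((m + 1) * L) :=
      Nat.mul_le_mul_right _ (by have := min_le_right (f (m + 1)) B; omega)
    have h2 : 2 ^ ((m + 1) * L) + (2 ^ L - 1) * 2 ^ ((m + 1) * L) = 2 ^ ((m + 1 + 1) * L) := by
      have h3 : 2 ^ ((m + 1 + 1) * L) = 2 ^ L * 2 ^ ((m + 1) * L) := by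
        rw [← pow_add]; congr 1; ring
      rw [h3]
      have h4 : 1 ≤ 2 ^ L := Nat.one_le_two_pow
      calc 2 ^ ((m + 1) * L) + (2 ^ L - 1) * 2 ^ ((m + 1) * L)
          = (1 + (2 ^ L - 1)) * 2 ^ ((m + 1) * L) := by ring
        _ = 2 ^ L * 2 ^ ((m + 1) * L) := by rw [Nat.add_sub_cancel' h4]
    omega

/-- **Digit extraction**: for `k ≤ m`, the `k`-th digit of the table is `min (f k, B)`
(`B < 2^L`). [cite: Buss1986, §2.5] -/
theorem tblNat_digit {f : ℕ → ℕ} {B L : ℕ} (hB : B < 2 ^ L) :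
    ∀ (m k : ℕ), k ≤ m → tblNat f B L m / 2 ^ (k * L) % 2 ^ L = min (f k) B := by
  intro m
  induction m with
  | zero =>
    intro k hk
    obtain rfl : k = 0 := Nat.le_zero.1 hk
    rw [tblNat_zero, zero_mul, pow_zero, Nat.div_one]
    exact Nat.mod_eq_of_lt (lt_of_le_of_lt (min_le_right _ _) hB)
  | succ m ih =>
    intro k hk
    rw [tblNat_succ]
    rcases Nat.lt_or_ge k (m + 1) with hlt | hge
    · -- an old digit: the new summand is a multiple of `2^{kL} · 2^L`
      obtain ⟨d, hd⟩ : ∃ d, (m + 1) * L = k * L + L + d * L := by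
        refine ⟨m - k, ?_⟩
        have : m + 1 = k + 1 + (m - k) := by omega
        rw [this]; ring
      rw [hd, pow_add, pow_add, show min (f (m + 1)) B * (2 ^ (k * L) * 2 ^ L * 2 ^ (d * L)) =
        (min (f (m + 1)) B * 2 ^ L * 2 ^ (d * L)) * 2 ^ (k * L) by ring,
        Nat.add_mul_div_right _ _ (Nat.two_pow_pos _),
        show min (f (m + 1)) B * 2 ^ L * 2 ^ (d * L) = (min (f (m + 1)) B * 2 ^ (d * L)) * 2 ^ L by ring,
        Nat.add_mul_mod_self_right]
      exact ih k (by omega)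
    · -- the new digit
      obtain rfl : k = m + 1 := le_antisymm hk hge
      rw [Nat.add_mul_div_right _ _ (Nat.two_pow_pos _), Nat.div_eq_of_lt (tblNat_lt hB m),
        zero_add]
      exact Nat.mod_eq_of_lt (lt_of_le_of_lt (min_le_right _ _) hB)

/-- The width source `2B + 1` of a table with entries `≤ B`: `|2B + 1| = |B| + 1` and
`B < 2^{|2B+1|}`. [folklore] -/
def widthOf (B : PVFun p) : PVFun p := ap₁ (bit true) B

/-- Semantics of `widthOf`. [folklore] -/
@[simp] theorem eval_widthOf (B : PVFun p) (y : Fin p → ℕ) : (widthOf B).eval y = 2 * B.eval y + 1 := by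
  simp [widthOf, Nat.bit_val]

/-- `|2B + 1| = |B| + 1`. [folklore] -/
theorem size_two_mul_add_one (B : ℕ) : Nat.size (2 * B + 1) = Nat.size B + 1 := by
  have h := Nat.size_bit (b := true) (n := B) (by simp [Nat.bit_val])
  rwa [Nat.bit_val, Bool.toNat_true] at h

/-- `B < 2^{|2B+1|}` (indeed `B < 2^{|B|}`). [folklore] -/
theorem lt_two_pow_size_width (B : ℕ) : B < 2 ^ Nat.size (2 * B + 1) :=
  lt_of_lt_of_le (Nat.lt_size_self B)
    (Nat.pow_le_pow_right two_pos (Nat.size_le_size (by omega)))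

/-- **The table of a symbol** (`tbl F B`, arguments `(ȳ, u)`): the code
`Σ_{i ≤ |u|} min (F(ȳ, i), B ȳ) · 2^{i·L}`, `L = |2·B ȳ + 1|`, of the sequence of values of `F`
at the lengths `0, …, |u|` truncated at `B ȳ`, by limited recursion on the notation of `u`:
`tbl (ȳ, 0) = min (F(ȳ,0), B)`, `tbl (ȳ, sⱼ y) = tbl (ȳ, y) + min (F(ȳ, |sⱼ y|), B) · (sⱼ y # c)`,
bound `(s₁ u) # c` (Buss 1986, §2.5, sequence coding; the collecting function of Krajíček 1995,
proof of Thm. 7.6.3). [cite: Buss1986, §2.5] -/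
def tbl (F : PVFun (p + 1)) (B : PVFun p) : PVFun (p + 1) :=
  limRec (minT (appLast F zero') B)
    (fun j => ap₂ add rv (ap₂ mul (minT (appWith F (ap₁ len (ap₁ (bit j) yv))) (wk (wk B)))
      (ap₂ smash (ap₁ (bit j) yv) (wk (wk (widthOf B))))))
    (ap₂ smash (ap₁ (bit true) lastv) (wk (widthOf B)))

/-- **Semantics of `tbl`**: `tbl F B (ȳ, u) = tblNat (i ↦ F(ȳ, i)) (B ȳ) |2 B ȳ + 1| |u|`.
[cite: Buss1986, §2.5] -/
theorem eval_tbl (F : PVFun (p + 1)) (B : PVFun p) (y : Fin p → ℕ) (u : ℕ) :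
    (tbl F B).eval (Fin.snoc y u) =
      tblNat (fun i => F.eval (Fin.snoc y i)) (B.eval y) (Nat.size (2 * B.eval y + 1)) (Nat.size u) := by
  have hB := lt_two_pow_size_width (B.eval y)
  induction u using Nat.binaryRec' with
  | zero =>
    rw [tbl, eval_limRec_zero, tblNat, Nat.size_zero]
    simp only [eval_minT, eval_appLast, eval_zero', eval_ap₂, eval_ap₁, eval_smash, eval_bit,
      eval_lastv, eval_wk, eval_widthOf, Matrix.cons_val_zero, Matrix.cons_val_one, sum_range_one,
      zero_mul, pow_zero, mul_one, Nat.bit_val, mul_zero, zero_add, Bool.toNat_true, Nat.size_one,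
      one_mul]
    exact min_eq_left (le_trans (min_le_right _ _) hB.le)
  | bit j w hw ih =>
    rw [tbl, eval_limRec_bit _ _ _ _ _ _ hw, ← tbl, ih, size_bit' hw, tblNat_succ]
    simp only [eval_ap₂, eval_ap₁, eval_add, eval_mul, eval_minT, eval_appWith, eval_len, eval_bit,
      eval_yv, eval_rv, eval_wk, eval_smash, eval_widthOf, eval_lastv, Matrix.cons_val_zero,
      Matrix.cons_val_one, size_bit' hw]
    refine min_eq_left ?_
    have hlt := tblNat_lt (f := fun i => F.eval (Fin.snoc y i)) hB (Nat.size w + 1)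
    rw [tblNat_succ] at hlt
    have e : Nat.size (Nat.bit true (Nat.bit j w)) = Nat.size w + 1 + 1 := by
      rw [size_bit' (fun _ => rfl), size_bit' hw]
    rw [e]
    exact hlt.le

/-- A table is below its bound: `tbl F B (ȳ, u) < 2^{(|u|+1)·|2B+1|} = (s₁ u) # (2B+1)`.
[cite: Buss1986, §2.5] -/
theorem eval_tbl_lt (F : PVFun (p + 1)) (B : PVFun p) (y : Fin p → ℕ) (u : ℕ) :
    (tbl F B).eval (Fin.snoc y u) < 2 ^ ((Nat.size u + 1) * Nat.size (2 * B.eval y + 1)) := by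
  rw [eval_tbl]
  exact tblNat_lt (lt_two_pow_size_width _) _

/-- **Decoding a table**: for `i ≤ |u|`, `entry (tbl F B (ȳ, u), i, 2 B ȳ + 1) = min (F(ȳ,i), B ȳ)`.
[cite: Buss1986, §2.5] -/
theorem entry_tbl (F : PVFun (p + 1)) (B : PVFun p) (y : Fin p → ℕ) {u i : ℕ} (hi : i ≤ Nat.size u) :
    entry.eval ![(tbl F B).eval (Fin.snoc y u), i, 2 * B.eval y + 1] =
      min (F.eval (Fin.snoc y i)) (B.eval y) := by
  rw [eval_entry_of_ne_zero _ _ _ (Nat.succ_ne_zero _), eval_tbl]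
  exact tblNat_digit (lt_two_pow_size_width _) _ _ hi

/-! ## Sharply bounded minimisation -/

/-- The least `i ≤ m` with `g i = 0`, and `m + 1` if there is none. [folklore] -/
def leastZero (g : ℕ → ℕ) : ℕ → ℕ
  | 0 => if g 0 = 0 then 0 else 1
  | m + 1 => if leastZero g m ≤ m then leastZero g m else if g (m + 1) = 0 then m + 1 else m + 2

/-- `leastZero g m ≤ m + 1`. [folklore] -/
theorem leastZero_le (g : ℕ → ℕ) (m : ℕ) : leastZero g m ≤ m + 1 := by
  induction m with
  | zero => simp only [leastZero]; split_ifs <;> omega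
  | succ m ih => simp only [leastZero]; split_ifs <;> omega

/-- Below `leastZero g m`, `g` does not vanish. [folklore] -/
theorem ne_zero_of_lt_leastZero (g : ℕ → ℕ) (m : ℕ) {i : ℕ} (hi : i < leastZero g m) : g i ≠ 0 := by
  induction m generalizing i with
  | zero =>
    simp only [leastZero] at hi
    split_ifs at hi with h
    · omega
    · obtain rfl : i = 0 := by omega
      exact h
  | succ m ih =>
    simp only [leastZero] at hi
    split_ifs at hi with h1 h2
    · exact ih hi
    · have hle := leastZero_le g m
      rcases Nat.lt_or_ge i (leastZero g m) with h | h
      · exact ih h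
      · obtain rfl : i = m + 1 := by omega
        -- impossible: `i < m + 1`
        omega
    · have hle := leastZero_le g m
      rcases Nat.lt_or_ge i (leastZero g m) with h | h
      · exact ih h
      · obtain rfl : i = m + 1 := by omega
        exact h2

/-- If `leastZero g m ≤ m` then `g` vanishes there. [folklore] -/
theorem eq_zero_of_leastZero_le (g : ℕ → ℕ) (m : ℕ) (h : leastZero g m ≤ m) : g (leastZero g m) = 0 := by
  induction m with
  | zero =>
    simp only [leastZero] at h ⊢
    split_ifs at h ⊢ with h0
    · exact h0
    · omega
  | succ m ih =>
    simp only [leastZero] at h ⊢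
    split_ifs at h ⊢ with h1 h2
    · exact ih h1
    · exact h2
    · omega

/-- If `g i = 0` then `leastZero g m ≤ i`. [folklore] -/
theorem leastZero_le_of_eq_zero (g : ℕ → ℕ) (m : ℕ) {i : ℕ} (h : g i = 0) :
    leastZero g m ≤ i := by
  by_contra hcon
  exact ne_zero_of_lt_leastZero g m (not_le.1 hcon) h

/-- **Sharply bounded minimisation** `lsearch G (ȳ, u)`: the least `i ≤ |u|` with `G(ȳ, i) = 0`,
and `|u| + 1` if there is none, by limited recursion on the notation of `u` (Cook 1975, §2;
Buss 1986, Ch. 6: sharply bounded quantifiers are eliminable in `PV`). [cite: Buss1986, Ch. 6] -/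
def lsearch (G : PVFun (p + 1)) : PVFun (p + 1) :=
  limRec (ap₃ cond (appLast G zero') zero' one')
    (fun j => selT rv (ap₁ len yv) rv
      (ap₃ cond (appWith G (ap₁ len (ap₁ (bit j) yv))) (ap₁ len (ap₁ (bit j) yv))
        (ap₁ succ (ap₁ len (ap₁ (bit j) yv)))))
    (ap₁ succ (ap₁ len lastv))

/-- **Semantics of `lsearch`**: `lsearch G (ȳ, u) = leastZero (i ↦ G(ȳ, i)) |u|`.
[cite: Buss1986, Ch. 6] -/
theorem eval_lsearch (G : PVFun (p + 1)) (y : Fin p → ℕ) (u : ℕ) :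
    (lsearch G).eval (Fin.snoc y u) = leastZero (fun i => G.eval (Fin.snoc y i)) (Nat.size u) := by
  induction u using Nat.binaryRec' with
  | zero =>
    rw [lsearch, eval_limRec_zero, Nat.size_zero, leastZero]
    simp only [eval_ap₃, eval_ap₁, eval_cond, eval_appLast, eval_zero', eval_one', eval_succ,
      eval_len, eval_lastv, Matrix.cons_val_zero, Matrix.cons_val_one, Matrix.cons_val,
      Nat.size_zero, zero_add]
    split_ifs <;> simp
  | bit j w hw ih =>
    rw [lsearch, eval_limRec_bit _ _ _ _ _ _ hw, ← lsearch, ih, size_bit' hw, leastZero]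
    simp only [eval_selT, eval_ap₃, eval_ap₁, eval_cond, eval_appWith, eval_succ, eval_len,
      eval_bit, eval_yv, eval_rv, eval_lastv, Matrix.cons_val_zero, Matrix.cons_val_one,
      Matrix.cons_val, size_bit' hw]
    have hle := leastZero_le (fun i => G.eval (Fin.snoc y i)) (Nat.size w)
    refine min_eq_left ?_
    split_ifs <;> omega

/-- `lsearch G (ȳ, u) ≤ |u| + 1`. [cite: Buss1986, Ch. 6] -/
theorem lsearch_le (G : PVFun (p + 1)) (y : Fin p → ℕ) (u : ℕ) :
    (lsearch G).eval (Fin.snoc y u) ≤ Nat.size u + 1 := by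
  rw [eval_lsearch]; exact leastZero_le _ _

/-- Below `lsearch G (ȳ, u)`, `G(ȳ, ·)` does not vanish. [cite: Buss1986, Ch. 6] -/
theorem ne_zero_of_lt_lsearch (G : PVFun (p + 1)) (y : Fin p → ℕ) (u : ℕ) {i : ℕ}
    (hi : i < (lsearch G).eval (Fin.snoc y u)) : G.eval (Fin.snoc y i) ≠ 0 := by
  rw [eval_lsearch] at hi; exact ne_zero_of_lt_leastZero _ _ hi

/-- If `lsearch G (ȳ, u) ≤ |u|` then `G(ȳ, ·)` vanishes there. [cite: Buss1986, Ch. 6] -/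
theorem eq_zero_of_lsearch_le (G : PVFun (p + 1)) (y : Fin p → ℕ) (u : ℕ)
    (h : (lsearch G).eval (Fin.snoc y u) ≤ Nat.size u) :
    G.eval (Fin.snoc y ((lsearch G).eval (Fin.snoc y u))) = 0 := by
  rw [eval_lsearch] at h ⊢; exact eq_zero_of_leastZero_le _ _ h

/-! ## Counterexample search along a notation -/

/-- **Counterexample search** `cex Gd (ȳ, x)`: `cex (ȳ, 0) = 0`; `cex (ȳ, sⱼ y)` keeps a value
already found, and otherwise records `sⱼ y` if `Gd(ȳ, y) ≠ 0` and `Gd(ȳ, sⱼ y) = 0`.  If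
`Gd(ȳ, 0) ≠ 0` and `Gd(ȳ, x) = 0` it finds `c ≠ 0` with `Gd(ȳ, ⌊c/2⌋) ≠ 0`, `Gd(ȳ, c) = 0`
(`cex_spec`): the function witnessing the failure of an induction on notation, by which open
`PIND` becomes a universal statement (Krajíček 1995, §5.3 and proof of Thm. 7.6.3; Cook 1975, §2).
[cite: Krajicek1995, §5.3] -/
def cex (Gd : PVFun (p + 1)) : PVFun (p + 1) :=
  limRec zero'
    (fun j => ap₃ cond rv
      (ap₃ cond (appWith Gd yv) zero' (ap₃ cond (appWith Gd (ap₁ (bit j) yv)) (ap₁ (bit j) yv) zero'))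
      rv)
    lastv

/-- **Specification of the counterexample search.** Writing `C = cex Gd (ȳ, x)` and
`Gd' z = Gd(ȳ, z)`: `C ≤ x`; if `C ≠ 0` then `Gd' C = 0` and `Gd' ⌊C/2⌋ ≠ 0`; if `C = 0` and
`Gd' 0 ≠ 0` then `Gd' x ≠ 0`. [cite: Krajicek1995, §5.3] -/
theorem cex_spec (Gd : PVFun (p + 1)) (y : Fin p → ℕ) (x : ℕ) :
    (cex Gd).eval (Fin.snoc y x) ≤ x ∧
    ((cex Gd).eval (Fin.snoc y x) ≠ 0 →
      Gd.eval (Fin.snoc y ((cex Gd).eval (Fin.snoc y x))) = 0 ∧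
      Gd.eval (Fin.snoc y ((cex Gd).eval (Fin.snoc y x) / 2)) ≠ 0) ∧
    ((cex Gd).eval (Fin.snoc y x) = 0 → Gd.eval (Fin.snoc y 0) ≠ 0 → Gd.eval (Fin.snoc y x) ≠ 0) := by
  induction x using Nat.binaryRec' with
  | zero =>
    rw [cex, eval_limRec_zero]
    simp
  | bit j w hw ih =>
    obtain ⟨ihle, ih1, ih2⟩ := ih
    have hne : Nat.bit j w ≠ 0 := Nat.bit_ne_zero_iff.2 hw
    rw [cex, eval_limRec_bit _ _ _ _ _ _ hw, ← cex]
    simp only [eval_ap₃, eval_ap₁, eval_cond, eval_appWith, eval_bit, eval_yv, eval_rv, eval_lastv,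
      eval_zero', Matrix.cons_val_zero, Matrix.cons_val_one, Matrix.cons_val]
    set C := (cex Gd).eval (Fin.snoc y w) with hC
    by_cases hC0 : C = 0
    · rw [if_pos hC0]
      by_cases hw0 : Gd.eval (Fin.snoc y w) = 0
      · rw [if_pos hw0, min_eq_left (Nat.zero_le _)]
        refine ⟨Nat.zero_le _, fun h => absurd rfl h, fun _ h0 => ?_⟩
        exact absurd hw0 (ih2 hC0 h0)
      · rw [if_neg hw0]
        by_cases hx0 : Gd.eval (Fin.snoc y (Nat.bit j w)) = 0
        · rw [if_pos hx0, min_self]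
          refine ⟨le_rfl, fun _ => ⟨hx0, ?_⟩, fun h => absurd h hne⟩
          rwa [Nat.bit_div_two]
        · rw [if_neg hx0, min_eq_left (Nat.zero_le _)]
          exact ⟨Nat.zero_le _, fun h => absurd rfl h, fun _ _ => hx0⟩
    · rw [if_neg hC0]
      have hCle : C ≤ Nat.bit j w := le_trans ihle (by rw [Nat.bit_val]; omega)
      rw [min_eq_left hCle]
      exact ⟨hCle, fun h => ih1 h, fun h => absurd h hC0⟩

/-! ## Limited recursion on notation, witnessing order of arguments -/

/-- `recW G T (ȳ, v, x)`: `H(ȳ, v, 0) = min (v, T(ȳ, 0))`,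
`H(ȳ, v, sⱼ y) = min (G(ȳ, sⱼ y, H(ȳ, v, y)), T(ȳ, sⱼ y))` — limited recursion on notation
(Cobham 1965; Cook 1975, §2) with the parameters first, then the start value, then the recursion
variable; `G` takes `(ȳ, x, w)` and `T` takes `(ȳ, x)`. [cite: Cook1975, §2] -/
def recW (G : PVFun (p + 2)) (T : PVFun (p + 1)) : PVFun (p + 2) :=
  let pars : Fin p → PVFun (p + 3) := fun i => proj (Fin.castSucc (Fin.castSucc (Fin.castSucc i)))
  let yT : PVFun (p + 3) := proj (Fin.castSucc (Fin.last (p + 1)))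
  let rT : PVFun (p + 3) := proj (Fin.last (p + 2))
  let parsK : Fin p → PVFun (p + 2) := fun i => proj (Fin.castSucc (Fin.castSucc i))
  limRec (n := p + 1) (proj (Fin.last p))
    (fun j => comp G (Fin.snoc (Fin.snoc pars (ap₁ (bit j) yT)) rT))
    (comp T (Fin.snoc parsK (proj (Fin.last (p + 1)))))

/-- `recW` at `0`. [cite: Cook1975, §2] -/
theorem eval_recW_zero (G : PVFun (p + 2)) (T : PVFun (p + 1)) (y : Fin p → ℕ) (v : ℕ) :
    (recW G T).eval (Fin.snoc (Fin.snoc y v) 0) = min v (T.eval (Fin.snoc y 0)) := by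
  rw [recW, eval_limRec_zero, eval_proj, Fin.snoc_last, eval_comp]
  congr 2
  funext i
  cases i using Fin.lastCases with
  | last => simp
  | cast i => simp

/-- `recW` at `sⱼ y ≠ 0`. [cite: Cook1975, §2] -/
theorem eval_recW_bit (G : PVFun (p + 2)) (T : PVFun (p + 1)) (y : Fin p → ℕ) (v : ℕ) {j : Bool}
    {w : ℕ} (hw : w = 0 → j = true) :
    (recW G T).eval (Fin.snoc (Fin.snoc y v) (Nat.bit j w)) =
      min (G.eval (Fin.snoc (Fin.snoc y (Nat.bit j w)) ((recW G T).eval (Fin.snoc (Fin.snoc y v) w))))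
        (T.eval (Fin.snoc y (Nat.bit j w))) := by
  rw [recW, eval_limRec_bit _ _ _ _ _ _ hw, ← recW, eval_comp, eval_comp]
  congr 2
  · funext i
    cases i using Fin.lastCases with
    | last => simp
    | cast i =>
      cases i using Fin.lastCases with
      | last => simp
      | cast i => simp
  · funext i
    cases i using Fin.lastCases with
    | last => simp
    | cast i => simp

/-- `recW G T (ȳ, v, x) ≤ T(ȳ, x)`. [cite: Cook1975, §2] -/
theorem eval_recW_le (G : PVFun (p + 2)) (T : PVFun (p + 1)) (y : Fin p → ℕ) (v x : ℕ) :
    (recW G T).eval (Fin.snoc (Fin.snoc y v) x) ≤ T.eval (Fin.snoc y x) := by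
  induction x using Nat.binaryRec' with
  | zero => rw [eval_recW_zero]; exact min_le_right _ _
  | bit j w hw _ => rw [eval_recW_bit _ _ _ _ hw]; exact min_le_right _ _

end PVFun

end Literature.Analysis.FunctionSpaces
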